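import Summits.Ventures.GridStability.Bench.WSCC9Deg4ATrajV2CctLower320
import Summits.Ventures.GridStability.Bench.WSCC9Deg4ATrajV2Levelup35o32L30PpRoa
import HarnessLib
-- PORT HOME/cert/sos-3/closer29200/gen_closer3.py (gridfusion-sos-3 g6) / source WSCC9-deg4-A-trajV2-levelup-35o32-L30-pp.json sha256:6134ee20a27483e8 (+ the V₂ chain b6593c9540996042 / 68f615735a25ed8b)

/-!
# «G1cct-WSCC9-LOWER-K ∀T ≤ 31/200 s» — the THRESHOLD sentence for every clearing time `T ≤ 31/200 s = 0.155 s`, CLOSED in the kernel: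
# `[0, 3/20]` by `clearing_le_3_20_returns` (V₂ at 18/17, sibling `…TrajV2CctLower320.lean`) ∪ leg 30 of model-1's 36-leg kernel tube inside
# `{V₂ ≤ 35/32}` by the level-up object's own zboxG box identity `traj_incl_L30` (glued literally through `KL30_ends` of `Bench/WSCC9KBoxSlices`)

Venture GRIDFUSION (LADDER-GRIDFUSION G1-cct; lead g8 RULINGS 9i (5) / 9t (3); sos-1 g10 RUN 16:10:25Z «the degree-4 expanding-interior lane now reads
0.115 → 0.140 → 0.145 → 0.150 → 0.155 s ∀T … 0.155 s is where this V₂ stops without a new lever»); seat gridfusion-sos-3 (g6), generator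
`HOME/cert/sos-3/closer29200/gen_closer3.py`. OBJECTS: the V₂ ROA at level 35/32 (`Bench/WSCC9Deg4ATrajV2Levelup35o32L30PpRoa`, this seat, on sos-5's staged level-up
set `Bench/WSCC9Deg4ATrajV2Levelup35o32L30Pp*`, A-object 6134ee20a27483e8…), model-1's tube `Models/WSCC9FaultOnTubeLegs36` (p537702) + receptacle
`Bench/WSCC9FaultTube36KBoxGlue` (p540274), `Bench/WSCC9KBoxAnySide` (p537108), `Bench/WSCC9KBoxSlices` (`KLs`, `KL30_sideOKG`, `KL30_ends`,
`bounds_of_ends`, `vars_ofFn_seven`). Leg 30 by INTERVALS would need ≥ 8 sub-slices at 35/32 (one box 1.2107, quarters 1.0307 / 1.0559 / 1.0819 / 1.1088 vs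
1.09375; this seat's probe 16:1xZ) — the Putinar box identity of the object is the natural route here.
CONTENTS. §1 `trajV2lu_clearing_returns_of_KLs` (receptacle + `trajV2lu_model_roa` at `γ = 35/32`), `trajV2lu_KL30_Vz_le` (`KBox.Z_mem_zboxG` +
`KL30_sideOKG` / `KL30_ends` + `…traj_incl_L30`, read through the rfl bridge `…_V_eq`). §2 the CLOSED sentence `clearing_le_31_200_returns` (`T ≤ 3/20`:
`clearing_le_3_20_returns`; else leg 30) + `clearing_le_31_200_returns_wellPosed` (∃! from the pre-fault machine state).
THREE COLUMNS. CERTIFIED: kernel (the decides + Putinar identities + tubes + the two ROA chains). VALIDATED (not here): float margin +0.00096 at 35/32;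
leg 31's box max 1.198 > 35/32; RK4 CCT_sim ≈ 0.176 s. MODELLED: classical WSCC9 M′ (MV-2 + MV-P + MV-SPD + MV-ω + MV-h12; bolted bus-7 fault cleared by
opening line 5–7; printed pre-fault point at synchronous speed). Honest framing (RULING 27 (B)): «CCT(M′) ≥ 31/200 s» is a kernel LOWER bound — never
«the CCT», never «the grid is stable». Supersedes `clearing_le_3_20_returns` in content.
[cite: AndersonFouad1977, Example 2.6 / §2.10; Moore1979, §8.1 eq. (8.10)]
-/

noncomputable section

open Real Set Filter Topology
open Literature.Computation.Certificates Literature.Computation.Certificates.SOS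
open Summit.Ventures.GridStability.Models Summit.Ventures.GridStability.Lyapunov
open Summit.Ventures.GridStability.Models.WSCC9.FaultOnLeg (legAt legs36 kboxAt K0 legs36_sliceOK)

namespace Summit.Ventures.GridStability.Bench.WSCC9

/-! ### §1 The receptacle at level 35/32 and «KLs 30 0 (1/200) ⊂ {V₂ ≤ 35/32}» -/

/-- **Clearing in the sub-slice `[k/200 + sa, k/200 + sb]` of leg `k` returns** (V₂ chain AT LEVEL 35/32), given model-1's slice admissibility and the
two kernel facts of the slice box (`sideOKG`, «KLs k sa sb ⊂ {V₂ ≤ 35/32}»): `KBox.clearingState36_mem` ⇒ `c 0 ∈ KLs k sa sb`; `KBox.abs_u_lt_pi_G`;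
`trajV2lu_model_roa` at `γ = 35/32`. [folklore] -/
theorem trajV2lu_clearing_returns_of_KLs {k : ℕ} (hk : k < 36) {sa sb : ℚ}
    (hs : (legAt legs36 k).sliceOK (kboxAt K0 legs36 k) sa sb = true) (hside : (KLs k sa sb).sideOKG = true)
    (hKS : ∀ x ∈ (KLs k sa sb).toSet, deg4_A_trajV2_deg4_GE11o8_T3o20_EXACT_Vz (deg2_A_SPdampH12_Z WSCC9.postB_SPdamp.angleOf x) ≤ trajV2lu_level)
    {T : ℝ} (hT1 : (k : ℝ) / 200 + (sa : ℝ) ≤ T) (hT2 : T ≤ (k : ℝ) / 200 + (sb : ℝ))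
    {Y : ℝ → ClassicalSwing.State 3} (hY : WSCC9.faultBus7Printed.IsSolutionOn Y (Icc 0 T))
    (hω0 : (Y 0).2 = 0) (ha2 : (Y 0).1 1 - (Y 0).1 0 ∈ WSCC9.a2Window) (ha3 : (Y 0).1 2 - (Y 0).1 0 ∈ WSCC9.a3Window)
    {c : ℝ → ClassicalSwing.State 3} (hc : WSCC9.postB_SPdamp.toModel.IsSolutionOn c (Ici 0))
    (hc0 : c 0 = ((Y T).1, fun j => (Y T).2 j - (WSCC9.omegaInf : ℝ))) :
    (∀ i : Fin 2, ∀ t, 0 ≤ t → |RecastData.u WSCC9.postB_SPdamp.angleOf (c t) i.succ| < π) ∧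
    (∀ i : Fin 2, Tendsto (fun t => RecastData.u WSCC9.postB_SPdamp.angleOf (c t) i.succ) atTop (𝓝 0)) ∧
    (∀ j : Fin 3, Tendsto (fun t => (c t).2 j) atTop (𝓝 0)) := by
  have hmem : c 0 ∈ (KLs k sa sb).toSet :=
    KBox.clearingState36_mem hk hs (KBox.ofSlice_coversSlice _) hT1 hT2 hY hω0 ha2 ha3 hc0
  have hV0 := hKS (c 0) hmem
  have h0win := KBox.abs_u_lt_pi_G (KLs k sa sb) hside hmem
  have key := trajV2lu_model_roa WSCC9.postB_SPdamp_eqData (γ := trajV2lu_level)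
    (by unfold trajV2lu_level; norm_num) le_rfl hc hV0 h0win
  exact ⟨key.2.1, key.2.2.1, key.2.2.2⟩

/-- **«KLs 30 0 (1/200) ⊂ {V₂ ≤ 35/32}»** (SOS-box route): every state of the leg-30 K-box has `V₂(Z x) ≤ 35/32` (any `δs` with `EqData δs`):
`KBox.Z_mem_zboxG` + `KL30_sideOKG` / `KL30_ends` (Bench/WSCC9KBoxSlices) + the certified identity `deg4_A_trajV2_levelup_35o32_L30_pp_traj_incl_L30` (+ the rfl bridges). [folklore] -/
theorem trajV2lu_KL30_Vz_le {δs : Fin 3 → ℝ} (hEq : WSCC9.postB_SPdamp.EqData δs) {x : ClassicalSwing.State 3}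
    (hx : x ∈ (KLs 30 0 (1 / 200)).toSet) : deg4_A_trajV2_deg4_GE11o8_T3o20_EXACT_Vz (deg2_A_SPdampH12_Z δs x) ≤ trajV2lu_level := by
  have hz := KBox.Z_mem_zboxG (KLs 30 0 (1 / 200)) KL30_sideOKG hEq hx
  obtain ⟨v0, v1, v2, v3, v4, v5, v6⟩ := vars_ofFn_seven (deg2_A_SPdampH12_Z δs x)
  have b0 := bounds_of_ends KL30_ends (hz 0)
  have b1 := bounds_of_ends KL30_ends (hz 1)
  have b2 := bounds_of_ends KL30_ends (hz 2)
  have b3 := bounds_of_ends KL30_ends (hz 3)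
  have b4 := bounds_of_ends KL30_ends (hz 4)
  have b5 := bounds_of_ends KL30_ends (hz 5)
  have b6 := bounds_of_ends KL30_ends (hz 6)
  rw [v0] at b0; rw [v1] at b1; rw [v2] at b2; rw [v3] at b3; rw [v4] at b4; rw [v5] at b5; rw [v6] at b6
  norm_num [List.getD] at b0 b1 b2 b3 b4 b5 b6
  have hM := deg4_A_trajV2_deg4_GE11o8_T3o20_EXACT_Z_mem_M δs x
  simp only [deg4_A_trajV2_deg4_GE11o8_T3o20_EXACT_M, mem_setOf_eq] at hM
  have h := deg4_A_trajV2_levelup_35o32_L30_pp_traj_incl_L30 (deg2_A_SPdampH12_Z δs x 0) (deg2_A_SPdampH12_Z δs x 1) (deg2_A_SPdampH12_Z δs x 2) (deg2_A_SPdampH12_Z δs x 3) (deg2_A_SPdampH12_Z δs x 4) (deg2_A_SPdampH12_Z δs x 5) (deg2_A_SPdampH12_Z δs x 6)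
    (by simp only [deg2_A_SPdampH12_Z_0]; linarith [b0.1]) (by simp only [deg2_A_SPdampH12_Z_0]; linarith [b0.2]) (by simp only [deg2_A_SPdampH12_Z_1]; linarith [b1.1]) (by simp only [deg2_A_SPdampH12_Z_1]; linarith [b1.2]) (by simp only [deg2_A_SPdampH12_Z_2]; linarith [b2.1]) (by simp only [deg2_A_SPdampH12_Z_2]; linarith [b2.2]) (by simp only [deg2_A_SPdampH12_Z_3]; linarith [b3.1]) (by simp only [deg2_A_SPdampH12_Z_3]; linarith [b3.2]) (by simp only [deg2_A_SPdampH12_Z_4]; linarith [b4.1]) (by simp only [deg2_A_SPdampH12_Z_4]; linarith [b4.2]) (by simp only [deg2_A_SPdampH12_Z_5]; linarith [b5.1]) (by simp only [deg2_A_SPdampH12_Z_5]; linarith [b5.2]) (by simp only [deg2_A_SPdampH12_Z_6]; linarith [b6.1]) (by simp only [deg2_A_SPdampH12_Z_6]; linarith [b6.2])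
    (by rw [deg4_A_trajV2_levelup_35o32_L30_pp_h1_eq']; exact hM.1) (by rw [deg4_A_trajV2_levelup_35o32_L30_pp_h2_eq']; exact hM.2)
  rw [deg4_A_trajV2_levelup_35o32_L30_pp_V_eq] at h
  simpa only [deg4_A_trajV2_deg4_GE11o8_T3o20_EXACT_Vz, trajV2lu_level] using h

/-! ### §2 The sentence -/

/-- **Rider «G1cct-WSCC9-LOWER-K ∀T ≤ 31/200 s», CLOSED.** For every clearing time `T ∈ [0, 31/200 s]`, every fault-on solution `Y` of
`WSCC9.faultBus7Printed` (bus 7 grounded, printed frame) on `[0, T]` from the printed pre-fault point at synchronous speed (`ω(0) = 0`, `δ₂(0) − δ₁(0) ∈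
a2Window`, `δ₃(0) − δ₁(0) ∈ a3Window`), and every post-fault solution `c` of `WSCC9.postB_SPdamp.toModel` (line 5–7 opened) on `[0, ∞)` from the state
cleared at `T` (`c 0 = (δ(T), ω(T) − ω∞′)`): NO relative angle deviation ever reaches `±π` (no pole slip), every `u_i(t) → 0` and every speed deviation
`→ 0`. Proof: `T ≤ 3/20` — `clearing_le_3_20_returns` (V₂ at 18/17, interval lineage); `T > 3/20` — leg 30, `trajV2lu_clearing_returns_of_KLs` with
`KL30_sideOKG` / `trajV2lu_KL30_Vz_le`. MODELLED: classical WSCC9 M′ (MV-2 + MV-P + MV-SPD + MV-ω + MV-h12); honest framing (RULING 27 (B)): «CCT(M′)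
≥ 31/200 s = 0.155 s» as a kernel LOWER bound beside Anderson–Fouad's simulated 5-cycle clearing (0.083 s) and the VALIDATED RK4 CCT_sim ≈ 0.176 s —
never «the CCT», never «the grid is stable». Supersedes `clearing_le_3_20_returns` in content. [folklore] -/
theorem clearing_le_31_200_returns {T : ℝ} (hT0 : 0 ≤ T) (hT : T ≤ 31 / 200)
    {Y : ℝ → ClassicalSwing.State 3} (hY : WSCC9.faultBus7Printed.IsSolutionOn Y (Icc 0 T))
    (hω0 : (Y 0).2 = 0) (ha2 : (Y 0).1 1 - (Y 0).1 0 ∈ WSCC9.a2Window) (ha3 : (Y 0).1 2 - (Y 0).1 0 ∈ WSCC9.a3Window)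
    {c : ℝ → ClassicalSwing.State 3} (hc : WSCC9.postB_SPdamp.toModel.IsSolutionOn c (Ici 0))
    (hc0 : c 0 = ((Y T).1, fun j => (Y T).2 j - (WSCC9.omegaInf : ℝ))) :
    (∀ i : Fin 2, ∀ t, 0 ≤ t → |RecastData.u WSCC9.postB_SPdamp.angleOf (c t) i.succ| < π) ∧
    (∀ i : Fin 2, Tendsto (fun t => RecastData.u WSCC9.postB_SPdamp.angleOf (c t) i.succ) atTop (𝓝 0)) ∧
    (∀ j : Fin 3, Tendsto (fun t => (c t).2 j) atTop (𝓝 0)) := by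
  by_cases h30 : T ≤ 3 / 20
  · exact clearing_le_3_20_returns hT0 h30 hY hω0 ha2 ha3 hc hc0
  · exact trajV2lu_clearing_returns_of_KLs (k := 30) (by norm_num) (legs36_sliceOK ⟨30, by norm_num⟩) KL30_sideOKG
      (fun x hx => trajV2lu_KL30_Vz_le WSCC9.postB_SPdamp_eqData hx) (by push_cast; linarith [not_le.1 h30]) (by push_cast; linarith)
      hY hω0 ha2 ha3 hc hc0

/-- **Rider «G1cct-WSCC9-LOWER-K ∀T ≤ 31/200 s», WELL-POSED FORM (∃!)** — only hypotheses: the clearing time and the PRE-FAULT MACHINE STATE `x₀`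
(ω = 0, printed relative angles): ∃! fault-on motion of `WSCC9.faultBus7Printed` on `ℝ` from `x₀`; for it ∃! post-fault motion of `WSCC9.postB_SPdamp.toModel`
from the state cleared at `T`; every such motion never pole-slips and has `u_i → 0`, `ω_j → 0`. MODELLED / honest framing as above. [folklore] -/
theorem clearing_le_31_200_returns_wellPosed {T : ℝ} (hT0 : 0 ≤ T) (hT : T ≤ 31 / 200)
    {x₀ : ClassicalSwing.State 3} (hω0 : x₀.2 = 0) (ha2 : x₀.1 1 - x₀.1 0 ∈ WSCC9.a2Window) (ha3 : x₀.1 2 - x₀.1 0 ∈ WSCC9.a3Window) :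
    (∃! Y : ℝ → ClassicalSwing.State 3, Y 0 = x₀ ∧ WSCC9.faultBus7Printed.IsSolutionOn Y univ) ∧
    ∀ Y : ℝ → ClassicalSwing.State 3, Y 0 = x₀ → WSCC9.faultBus7Printed.IsSolutionOn Y univ →
      (∃! c : ℝ → ClassicalSwing.State 3, c 0 = ((Y T).1, fun j => (Y T).2 j - (WSCC9.omegaInf : ℝ)) ∧
          WSCC9.postB_SPdamp.toModel.IsSolutionOn c univ) ∧
      ∀ c : ℝ → ClassicalSwing.State 3, c 0 = ((Y T).1, fun j => (Y T).2 j - (WSCC9.omegaInf : ℝ)) →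
        WSCC9.postB_SPdamp.toModel.IsSolutionOn c univ →
          (∀ i : Fin 2, ∀ t, 0 ≤ t → |RecastData.u WSCC9.postB_SPdamp.angleOf (c t) i.succ| < π) ∧
          (∀ i : Fin 2, Tendsto (fun t => RecastData.u WSCC9.postB_SPdamp.angleOf (c t) i.succ) atTop (𝓝 0)) ∧
          (∀ j : Fin 3, Tendsto (fun t => (c t).2 j) atTop (𝓝 0)) := by
  refine ⟨WSCC9.faultBus7Printed.existsUnique_isSolutionOn_univ x₀, fun Y hY0 hY => ?_⟩
  refine ⟨WSCC9.postB_SPdamp.toModel.existsUnique_isSolutionOn_univ _, fun c hc0 hc => ?_⟩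
  have hY' : WSCC9.faultBus7Printed.IsSolutionOn Y (Icc 0 T) := hY.mono (subset_univ _)
  rw [← hY0] at hω0 ha2 ha3
  exact clearing_le_31_200_returns hT0 hT hY' hω0 ha2 ha3 (hc.mono (subset_univ _)) hc0

end Summit.Ventures.GridStability.Bench.WSCC9

end
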